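import Summits.MatrixMultiplication.MatrixMultiplication.Theorems.AbelianSTPPCensusTAStatFSplit

/-!
# T_A static certificate, range `6780 … 6833` (multi-parameter k-member tree at `τ = 2371/1000`): kernel pieces of the cell `(15, 15, 18)` (volume `4050`) at the orders `6802 … 6804`, part 1/8

Cell mm-stpp (rung F-M1), tier T_A = «beat `2.371`, the record exponent (ADVXXZ'25 / DEK+26 rounded)»; seat mm-stpp-vp-p2 (gen 7).  Root-split layout (`AbelianSTPPCensusTAStatKMemberXSplit.lean`, `…XWalk.lean`, `AbelianSTPPCensusTAStatFSplit.lean`): the (cell, order) tree(s) have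
1159243 nodes — beyond one `decide` — and is cut along list positions into `goIR` pieces / small subtrees / descent children of ≤ 4·10⁴ nodes each
(this file: 5 pieces, 139784 nodes; sizes from the exact twin seat twin/tastat9.py, kit j314549), assembled in `AbelianSTPPCensusTAStatFCkS4050o6802t6804.lean`.
`decide` with kernel reduction (standard axioms; no `native_decide`), `Elab.async false`.
WHAT THIS IS NOT: arithmetic on shape lists only; no statement about STPP families or `ω`.
-/

set_option linter.dupNamespace false
set_option autoImplicit false
set_option Elab.async false

namespace Summit.MatrixMultiplication.MatrixMultiplication.Theorems.TAStatF

open ShapeCert (gainOf2371j)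
open TECert (vol)

set_option maxHeartbeats 0 in
/-- root positions `0 … 0` (bucket `70`, order `6802`): 14024 nodes [original] -/
theorem s4050o6802b70rg0 : TAStatKM.goIR gainOf2371j 4050 (fun A' ms' => TAStatKM.treeKX tb m2l gainOf2371j (rowOf 4050) (xrowOf 4050) (gainOf2371j 4050) 765 4050 1482 15 225 6802 kmax 81 A' 70 ms') TAStatKM.agg0 (m2l 70) 0 1 = true := by decide +kernel

set_option maxHeartbeats 0 in
/-- root positions `1 … 1` (bucket `70`, order `6802`): 30563 nodes [original] -/
theorem s4050o6802b70rg1 : TAStatKM.goIR gainOf2371j 4050 (fun A' ms' => TAStatKM.treeKX tb m2l gainOf2371j (rowOf 4050) (xrowOf 4050) (gainOf2371j 4050) 765 4050 1482 15 225 6802 kmax 81 A' 70 ms') TAStatKM.agg0 (m2l 70) 1 1 = true := by decide +kernel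

set_option maxHeartbeats 0 in
/-- root positions `2 … 2` (bucket `70`, order `6802`): 39226 nodes [original] -/
theorem s4050o6802b70rg2 : TAStatKM.goIR gainOf2371j 4050 (fun A' ms' => TAStatKM.treeKX tb m2l gainOf2371j (rowOf 4050) (xrowOf 4050) (gainOf2371j 4050) 765 4050 1482 15 225 6802 kmax 81 A' 70 ms') TAStatKM.agg0 (m2l 70) 2 1 = true := by decide +kernel

set_option maxHeartbeats 0 in
/-- root positions `3 … 3` (bucket `70`, order `6802`): 24943 nodes [original] -/
theorem s4050o6802b70rg3 : TAStatKM.goIR gainOf2371j 4050 (fun A' ms' => TAStatKM.treeKX tb m2l gainOf2371j (rowOf 4050) (xrowOf 4050) (gainOf2371j 4050) 765 4050 1482 15 225 6802 kmax 81 A' 70 ms') TAStatKM.agg0 (m2l 70) 3 1 = true := by decide +kernel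

set_option maxHeartbeats 0 in
/-- positions `0 … 1` of a node at bucket `70` (1 companion(s), list from `4`): 31028 nodes [original] -/
theorem s4050o6802b70rc4g0 : TAStatKM.goIR gainOf2371j 4050 (fun A' ms' => TAStatKM.treeKX tb m2l gainOf2371j (rowOf 4050) (xrowOf 4050) (gainOf2371j 4050) 765 4050 1482 15 225 6802 kmax 80 A' 70 ms') (TAStatKM.addM (gainOf2371j (vol (14, 16, 17))) TAStatKM.agg0 (14, 16, 17)) ((14, 16, 17) :: (m2l 70).drop 5) 0 2 = true := by decide +kernel

end Summit.MatrixMultiplication.MatrixMultiplication.Theorems.TAStatF
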